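import Literature.RepresentationTheory.KonnoKonno2007.JointHarmonicsPosPlane
import Literature.RepresentationTheory.KonnoKonno2007.JointHarmonicsMixedPlane
import Literature.RepresentationTheory.Ichino2022.FockKTypeWorkedPlanes

/-!
# Konno–Konno 2007, Lemma 5.3 (iii) at `U(2,1) × U(2,0)` and `U(2,1) × U(1,1)`: the weights of the joint-harmonic
# highest-weight vectors, and the unconditional Ichino Lemma 7.10 for the two explicit Fock models

Source: T. Konno, K. Konno, *On doubling construction for real unitary dual pairs*, Kyushu J. Math. **61** (2007)
35–82, doi:10.2206/kyushujm.61.35 — bib key `KonnoKonno2007`; held as [corpus: paper:doi-10-2206-kyushujm-61-35]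
(journal page = PDF page + 34).  The two sibling files `…KonnoKonno2007.JointHarmonicsPosPlane` (signature
`U(2,1) × U(2,0)`, Ichino `(p,q;r,s) = (2,0;2,1)`) and `…KonnoKonno2007.JointHarmonicsMixedPlane` (`U(2,1) × U(1,1)`,
Ichino `(1,1;2,1)`) type the explicit polynomial Fock models, the joint-harmonic operators (5.1), the vectors `Δ_{abcd}`
with Lemma 5.3 (i)–(ii) PROVED, and reduce Ichino's Lemma 7.10 [Ichino2022ThetaReal, §7.5] for the model to
**Lemma 5.3 (iii)** — "*(iii) Any `b̄_V ⊕ b_W`-highest weight vector in the `k_{V,ℂ} ⊕ k_{W,ℂ}`-module `J_{V,W,ξ}` is of the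
form `Δ_{abcd}`*" [corpus: paper:doi-10-2206-kyushujm-61-35 p0040 L51–52], of which the print says only "*Proof. Only
(iii) needs an explanation. However, this is proved in the same way as in [KV78, Proposition III 6.1]. We omit the
details.*" [ibid. p0041 L30–31] — taken there as the HYPOTHESIS `H` of `PosPlane.lemma_7_10_of_classification`,
`MixedPlane.lemma_7_10_of_classification`.

## What this file proves (nothing is asserted; no `def … : Prop` is introduced)

* `PosPlane.IsHWVector.weights` — Lemma 5.3 (iii) at `U(2,1) × U(2,0)` at the level of WEIGHTS (which is what Thm 5.4 /
  Lemma 7.10 consume): a joint harmonic `K_V × K_W`-highest-weight vector of `ℂ[z_{aj}, w_j]` with `U(W)`-weight `(k₀, k₁)`,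
  `U(2)_V`-weight `(n₀, n₁)` and `w`-degree `e` has `(k₀, k₁; n₀, n₁; e) = (α+β, β−d; α+β, β; d)` for some `α β d : ℕ` with
  `β = 0 ∨ d = 0` — the weights of `Δ_{abcd} = PosPlane.kkVec α β d = z_{00}^α (det z)^β w_1^d`;
* `PosPlane.lemma_7_10` — hence `(explicitPosPlane S hp hr hs).Lemma_7_10` UNCONDITIONALLY (every splitting datum `S` of
  signature `(2,0;2,1)`), and the hypothesis-free instance `PosPlane.corresponds_wedge_iff` of the consumer
  `…Ichino2022.FockKTypeWorkedPlanes` (`WorkedLines.corresponds_wedge_iff_posPlane`);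
* `MixedPlane.IsHWVector.weights` — Lemma 5.3 (iii) at `U(2,1) × U(1,1)` at the level of weights: the weights are those of
  `MixedPlane.kkVec i j k l = z_0^i w^j v^k y_1^l` with `(j = 0 ∨ k = 0) ∧ (i = 0 ∨ j = 0) ∧ (l = 0 ∨ k = 0)`;
* `MixedPlane.lemma_7_10` — `(explicitMixedPlane S hp hq hr hs).Lemma_7_10` unconditionally.

## The argument (a short replacement for [KV78, Prop. III 6.1] at these two signatures)

Everything is elementary calculus on `MvPolynomial`, in characteristic `0`:
* §0: Euler's identity for an INTEGER weight (`euler_identity`: `Σ_v w(v) · X_v ∂_v g = m · g` for `g` weighted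
  homogeneous of weight `m`; Mathlib's `IsWeightedHomogeneous.sum_weight_X_mul_pderiv` is the `ℕ`-weighted case, the
  tree's torus weights are signed), the coefficient formulae of `X_i ∂_i`, `X_i ∂_j` and `X_i X_j ∂_i ∂_j`, and the weight
  equations of a support monomial;
* `PosPlane` (§1): for a joint highest-weight vector `f`, (a) the column raising part `C f = z_{00}∂_{01} f + z_{10}∂_{11} f`
  vanishes — `Σ_a z_{a0} Δ_a f = 0` and `E_W f = 0` give `(Eul₀ + N_{w_1})(C f) = 0`, while Euler on `C f` for the
  non-negative weight `colW 0 + wDeg` gives `(Eul₀ + N_{w_1})(C f) = (k₀ + e + 1) C f` — hence `w_1 ∂_{w_0} f = 0` and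
  `∂_{w_0} f = 0`; (b) `Σ_a z_{a1} Δ_a f = 0` and Euler on `∂_{w_1} f` give `e = 0 ∨ k₁ + e = 0`; (c) the identity
  `∂_{10}(C f) − ∂_{01}(E_V f) = (z_{10}∂_{10} − z_{01}∂_{01}) ∂_{11} f` and Euler on `∂_{11} f` give `k₀ = n₀`; (d) for
  `e = 0`, dominance `n₁ ≤ n₀` by an extremal-monomial argument (a support monomial with the least `z_{11}`-exponent has a
  neighbour coefficient of `E_V f` that cannot cancel); the weights are then read off one support monomial.
* `MixedPlane` (§2): the Casimir-type identity `z_1 · ∂_{z_0}(E_V f) − y_0 · ∂_{y_1}(E_V f) + (z_0 y_0 + z_1 y_1) · D₊ f =`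
  a DIAGONAL operator with non-negative coefficients applied to `f` shows that `z_1` and `y_0` never occur in `f`; the
  single-term families `Δ⁺_0`, `Δ⁻_1`, `D₋` of (5.1) forbid the products `z_0 w`, `y_1 v`, `v w` in the support; the weights
  are read off one support monomial.

Deliberately NOT here: the multiplicity-one half of (iii) (that such a vector is a scalar multiple of `Δ_{abcd}`; not
needed by Thm 5.4 / Lemma 7.10, whose dictionary `FockHarmonics.corresponds` only records weights), and the
identification of the polynomial models with the `K × K′`-finite vectors of a constructed archimedean Weil datum (as in the
sibling files).

## References

* [KonnoKonno2007] T. Konno, K. Konno, Kyushu J. Math. 61 (2007) 35–82, §5.1 (5.1), §5.2 Lemma 5.3, Thm 5.4.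
* [Ichino2022ThetaReal] A. Ichino, Adv. Math. 398 (2022) 108188, §7.5 Lemma 7.10.
* [KashiwaraVergne1978] M. Kashiwara, M. Vergne, Invent. Math. 44 (1978) 1–47, Ch. III Prop. 6.1 (the printed method).

Provenance: pub-hodgecm2 literature fan-out row B09-2 (typer seat `literature-prover-pub-hodgecm2-t-b09-2`), closing the
hypotheses left open by row B09-1.
-/

namespace Literature.RepresentationTheory.KonnoKonno2007

open MvPolynomial Finsupp
open Literature.RepresentationTheory.Ichino2022

noncomputable section

/-! ## §0 Generic tools: coefficients of Euler-type operators, Euler's identity for integer weights -/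

section Tools

variable {σ : Type*}

/-- Coefficient formula for the number operator: `coeff_d (X_i ∂_i g) = d_i · coeff_d g`. [folklore] -/
private theorem coeff_X_mul_pderiv_self (i : σ) (g : MvPolynomial σ ℂ) (d : σ →₀ ℕ) :
    coeff d (X i * pderiv i g) = (d i : ℂ) * coeff d g := by
  classical
  induction g using MvPolynomial.induction_on' with
  | monomial m a =>
    rw [X_mul_pderiv_monomial, coeff_smul, coeff_monomial]
    split_ifs with h
    · subst h; simp [nsmul_eq_mul]
    · simp
  | add p q hp hq => simp [mul_add, hp, hq]

/-- Coefficient formula for `X_i ∂_j`, `i ≠ j`: `coeff_d (X_i ∂_j g) = (d_j + 1) · coeff_{d − e_i + e_j} g` if `d_i ≥ 1`,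
else `0`. [folklore] -/
private theorem coeff_X_mul_pderiv_of_ne [DecidableEq σ] {i j : σ} (hij : i ≠ j) (g : MvPolynomial σ ℂ)
    (d : σ →₀ ℕ) :
    coeff d (X i * pderiv j g) =
      if d i = 0 then 0 else ((d j : ℂ) + 1) * coeff (d - Finsupp.single i 1 + Finsupp.single j 1) g := by
  rw [coeff_X_mul']
  by_cases hi : d i = 0
  · simp [hi]
  · rw [if_pos (Finsupp.mem_support_iff.mpr hi), if_neg hi, coeff_pderiv]
    have : (d - Finsupp.single i 1 : σ →₀ ℕ) j = d j := by
      rw [Finsupp.tsub_apply, Finsupp.single_apply, if_neg hij, tsub_zero]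
    rw [this, mul_comm]

/-- Coefficient formula for `X_i X_j ∂_i ∂_j`, `i ≠ j`: `coeff_d = d_i d_j · coeff_d g`. [folklore] -/
private theorem coeff_X_mul_X_mul_pderiv_pderiv {i j : σ} (hij : j ≠ i) (g : MvPolynomial σ ℂ) (d : σ →₀ ℕ) :
    coeff d (X i * (X j * pderiv i (pderiv j g))) = (d i : ℂ) * ((d j : ℂ) * coeff d g) := by
  have : X i * (X j * pderiv i (pderiv j g)) = X i * pderiv i (X j * pderiv j g) := by
    rw [pderiv_mul, pderiv_X_of_ne hij, zero_mul, zero_add]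
  rw [this, coeff_X_mul_pderiv_self, coeff_X_mul_pderiv_self]

/-- If `∂_i ∂_j g = 0` (`i ≠ j`), no monomial of `g` contains both `X_i` and `X_j`: `d_i d_j = 0` on the support
(characteristic `0`). [folklore] -/
private theorem mul_apply_eq_zero_of_pderiv_pderiv {i j : σ} (hij : j ≠ i) {g : MvPolynomial σ ℂ}
    (h : pderiv i (pderiv j g) = 0) {d : σ →₀ ℕ} (hd : coeff d g ≠ 0) : d i * d j = 0 := by
  have h1 : X i * (X j * pderiv i (pderiv j g)) = 0 := by rw [h, mul_zero, mul_zero]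
  have h2 := congrArg (coeff d) h1
  rw [coeff_X_mul_X_mul_pderiv_pderiv hij, coeff_zero, ← mul_assoc] at h2
  exact_mod_cast (mul_eq_zero.mp h2).resolve_right hd

/-- The weight equation of a support monomial of a weighted-homogeneous polynomial, over a `Fintype` of variables:
`Σ_i d_i · w_i = m`. [folklore] -/
private theorem sum_mul_weight_eq_of_coeff_ne_zero [Fintype σ] {w : σ → ℤ} {g : MvPolynomial σ ℂ} {m : ℤ}
    (h : IsWeightedHomogeneous w g m) {d : σ →₀ ℕ} (hd : coeff d g ≠ 0) :
    ∑ i, (d i : ℤ) * w i = m := by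
  have := h hd
  rw [weight_apply, Finsupp.sum_fintype _ _ (fun i => by simp)] at this
  simpa [nsmul_eq_mul] using this

/-- **Euler's identity for an integer weight**: `Σ_i w_i · X_i ∂_i g = m · g` for `g` weighted homogeneous of weight
`m : ℤ` (Mathlib's `IsWeightedHomogeneous.sum_weight_X_mul_pderiv` is the case of `ℕ`-valued weights). [folklore] -/
private theorem euler_identity [Fintype σ] {w : σ → ℤ} {g : MvPolynomial σ ℂ} {m : ℤ}
    (h : IsWeightedHomogeneous w g m) :
    ∑ i, (w i : MvPolynomial σ ℂ) * (X i * pderiv i g) = (m : MvPolynomial σ ℂ) * g := by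
  classical
  ext d
  rw [coeff_sum]
  simp_rw [← map_intCast (C : ℂ →+* MvPolynomial σ ℂ), coeff_C_mul, coeff_X_mul_pderiv_self]
  by_cases hd : coeff d g = 0
  · simp [hd]
  · have key := sum_mul_weight_eq_of_coeff_ne_zero h hd
    simp_rw [← mul_assoc]
    rw [← Finset.sum_mul]
    congr 1
    rw [← key]
    push_cast
    simp_rw [mul_comm]

/-- A non-zero weighted-homogeneous polynomial for a pointwise non-negative weight has non-negative weight. [folklore] -/
private theorem weight_nonneg_of_ne_zero [Fintype σ] {w : σ → ℤ} {g : MvPolynomial σ ℂ} {m : ℤ}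
    (h : IsWeightedHomogeneous w g m) (hw : ∀ i, 0 ≤ w i) (hg : g ≠ 0) : 0 ≤ m := by
  obtain ⟨d, hd⟩ := exists_coeff_ne_zero hg
  rw [← sum_mul_weight_eq_of_coeff_ne_zero h hd]
  exact Finset.sum_nonneg fun i _ => mul_nonneg (by positivity) (hw i)

/-- Weighted homogeneity for two weights gives weighted homogeneity for their sum. [folklore] -/
private theorem isWeightedHomogeneous_add_weight {w₁ w₂ : σ → ℤ} {g : MvPolynomial σ ℂ} {m₁ m₂ : ℤ}
    (h₁ : IsWeightedHomogeneous w₁ g m₁) (h₂ : IsWeightedHomogeneous w₂ g m₂) :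
    IsWeightedHomogeneous (w₁ + w₂) g (m₁ + m₂) := by
  intro d hd
  rw [← h₁ hd, ← h₂ hd]
  simp only [weight_apply, Finsupp.sum, Pi.add_apply, smul_add, Finset.sum_add_distrib]

/-- Transport of weighted homogeneity along an equality of weights. [folklore] -/
private theorem isWeightedHomogeneous_of_eq {w : σ → ℤ} {g : MvPolynomial σ ℂ} {m n : ℤ}
    (h : IsWeightedHomogeneous w g m) (e : m = n) : IsWeightedHomogeneous w g n := e ▸ h

/-- Partial derivatives commute. [folklore] -/
private theorem pderiv_comm (i j : σ) (p : MvPolynomial σ ℂ) :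
    pderiv i (pderiv j p) = pderiv j (pderiv i p) := by
  classical
  induction p using MvPolynomial.induction_on with
  | C a => simp only [pderiv_C, map_zero]
  | add p q hp hq => simp only [map_add, hp, hq]
  | mul_X p k hp =>
    simp only [pderiv_mul, map_add, hp, pderiv_X]
    by_cases hik : i = k <;> by_cases hjk : j = k <;> simp [hik, hjk, eq_comm]

end Tools

/-! ## §1 `U(2,1) × U(2,0)`: the model `ℂ[z_{aj}, w_j]` of `…JointHarmonicsPosPlane` -/

namespace PosPlane

-- Variables: `Sum.inl (a, j)` is `z_{aj}` (block `V⁺ ⊗ W⁺`), `Sum.inr j` is `w_j` (block `V⁻ ⊗ W⁺`).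

/-- A sum over the six variables, written out. [folklore] -/
private theorem sum_var {β : Type*} [AddCommMonoid β] (F : Var → β) :
    ∑ v, F v = F (Sum.inl (0, 0)) + F (Sum.inl (0, 1)) + F (Sum.inl (1, 0)) + F (Sum.inl (1, 1))
      + F (Sum.inr 0) + F (Sum.inr 1) := by
  rw [Fintype.sum_sum_type, Fintype.sum_prod_type]
  simp only [Fin.sum_univ_two]
  abel

variable {f : Model} {k₀ k₁ n₀ n₁ e : ℤ}

/-- `E_V = z_{00} ∂_{z_{10}} + z_{01} ∂_{z_{11}}` as an operator on the model. [cite: KonnoKonno2007, §5.2 (5.3) p. 72] -/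
theorem EV_eq (g : Model) :
    EV g = X (Sum.inl (0, 0)) * pderiv (Sum.inl (1, 0)) g + X (Sum.inl (0, 1)) * pderiv (Sum.inl (1, 1)) g := by
  have : EV = (X (Sum.inl (0, 0)) : Model) • pderiv (Sum.inl (1, 0))
      + (X (Sum.inl (0, 1)) : Model) • pderiv (Sum.inl (1, 1)) := by
    refine MvPolynomial.derivation_ext (fun v => ?_)
    rcases v with ⟨a, j⟩ | j
    · fin_cases a <;> fin_cases j <;> simp [evGen]
    · simp [evGen]
  simpa [smul_eq_mul] using congrArg (fun D => D g) this

/-- `E_W = z_{00} ∂_{z_{01}} + z_{10} ∂_{z_{11}} − w_1 ∂_{w_0}` as an operator on the model.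
[cite: KonnoKonno2007, §5.2 (5.3) p. 72] -/
theorem EW_eq (g : Model) :
    EW g = X (Sum.inl (0, 0)) * pderiv (Sum.inl (0, 1)) g + X (Sum.inl (1, 0)) * pderiv (Sum.inl (1, 1)) g
      - X (Sum.inr 1) * pderiv (Sum.inr 0) g := by
  have : EW = (X (Sum.inl (0, 0)) : Model) • pderiv (Sum.inl (0, 1))
      + (X (Sum.inl (1, 0)) : Model) • pderiv (Sum.inl (1, 1))
      - (X (Sum.inr 1) : Model) • pderiv (Sum.inr 0) := by
    refine MvPolynomial.derivation_ext (fun v => ?_)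
    rcases v with ⟨a, j⟩ | j
    · fin_cases a <;> fin_cases j <;> simp [ewGen]
    · fin_cases j <;> simp [ewGen]
  simpa [smul_eq_mul, sub_eq_add_neg] using congrArg (fun D => D g) this

/-- Euler's identity for the `U(W)`-weight `colW 0`. [folklore] -/
private theorem euler_col0 {g : Model} {m : ℤ} (h : IsWeightedHomogeneous (colW 0) g m) :
    X (Sum.inl (0, 0)) * pderiv (Sum.inl (0, 0)) g + X (Sum.inl (1, 0)) * pderiv (Sum.inl (1, 0)) g
      - X (Sum.inr 0) * pderiv (Sum.inr 0) g
      = (m : Model) * g := by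
  have := euler_identity h
  rw [sum_var] at this
  simp [colW] at this
  linear_combination this

/-- Euler's identity for the `U(W)`-weight `colW 1`. [folklore] -/
private theorem euler_col1 {g : Model} {m : ℤ} (h : IsWeightedHomogeneous (colW 1) g m) :
    X (Sum.inl (0, 1)) * pderiv (Sum.inl (0, 1)) g + X (Sum.inl (1, 1)) * pderiv (Sum.inl (1, 1)) g
      - X (Sum.inr 1) * pderiv (Sum.inr 1) g
      = (m : Model) * g := by
  have := euler_identity h
  rw [sum_var] at this
  simp [colW] at this
  linear_combination this

/-- Euler's identity for the `U(2)_V`-weight `rowW 0`. [folklore] -/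
private theorem euler_row0 {g : Model} {m : ℤ} (h : IsWeightedHomogeneous (rowW 0) g m) :
    X (Sum.inl (0, 0)) * pderiv (Sum.inl (0, 0)) g + X (Sum.inl (0, 1)) * pderiv (Sum.inl (0, 1)) g = (m : Model) * g := by
  have := euler_identity h
  rw [sum_var] at this
  simp [rowW] at this
  linear_combination this

/-- Euler's identity for the `w`-degree `wDeg`. [folklore] -/
private theorem euler_wDeg {g : Model} {m : ℤ} (h : IsWeightedHomogeneous wDeg g m) :
    X (Sum.inr 0) * pderiv (Sum.inr 0) g + X (Sum.inr 1) * pderiv (Sum.inr 1) g = (m : Model) * g := by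
  have := euler_identity h
  rw [sum_var] at this
  simp [wDeg] at this
  linear_combination this

/-! ### The weight equations of a support monomial -/

/-- The five torus weights of a monomial `d` in the support of a joint highest-weight vector:
`d_{z00} + d_{z10} − d_{w0} = k₀`, `d_{z01} + d_{z11} − d_{w1} = k₁`, `d_{z00} + d_{z01} = n₀`, `d_{z10} + d_{z11} = n₁`,
`d_{w0} + d_{w1} = e`. [cite: KonnoKonno2007, Lemma 5.2 p. 73] -/
theorem IsHWVector.support_eqs (hf : IsHWVector f k₀ k₁ n₀ n₁ e) {d : Var →₀ ℕ} (hd : coeff d f ≠ 0) :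
    (d (Sum.inl (0, 0)) : ℤ) + d (Sum.inl (1, 0)) - d (Sum.inr 0) = k₀ ∧
      (d (Sum.inl (0, 1)) : ℤ) + d (Sum.inl (1, 1)) - d (Sum.inr 1) = k₁ ∧
      (d (Sum.inl (0, 0)) : ℤ) + d (Sum.inl (0, 1)) = n₀ ∧ (d (Sum.inl (1, 0)) : ℤ) + d (Sum.inl (1, 1)) = n₁ ∧
      (d (Sum.inr 0) : ℤ) + d (Sum.inr 1) = e := by
  have h0 := sum_mul_weight_eq_of_coeff_ne_zero hf.col0 hd
  have h1 := sum_mul_weight_eq_of_coeff_ne_zero hf.col1 hd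
  have h2 := sum_mul_weight_eq_of_coeff_ne_zero hf.row0 hd
  have h3 := sum_mul_weight_eq_of_coeff_ne_zero hf.row1 hd
  have h4 := sum_mul_weight_eq_of_coeff_ne_zero hf.wdeg hd
  rw [sum_var] at h0 h1 h2 h3 h4
  simp [colW, rowW, wDeg] at h0 h1 h2 h3 h4
  refine ⟨?_, ?_, ?_, ?_, ?_⟩ <;> linarith

/-! ### (a) The column raising part `C f` vanishes; hence `∂_{w_0} f = 0` -/

/-- For a joint highest-weight vector `f`, `z_{00} ∂_{z_{01}} f + z_{10} ∂_{z_{11}} f = 0`: by `E_W f = 0` this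
polynomial equals `w_1 ∂_{w_0} f`; the harmonic equations `Σ_a z_{a0} Δ_a f = 0` show that `Eul₀ + N_{w_1}` kills it,
whereas Euler's identity for the non-negative weight `colW 0 + wDeg` says that `Eul₀ + N_{w_1}` multiplies it by
`k₀ + e + 1 ≥ 1`. [cite: KonnoKonno2007, Lemma 5.3 (iii) p. 74] -/
theorem IsHWVector.colRaise_eq_zero (hf : IsHWVector f k₀ k₁ n₀ n₁ e) :
    X (Sum.inl (0, 0)) * pderiv (Sum.inl (0, 1)) f + X (Sum.inl (1, 0)) * pderiv (Sum.inl (1, 1)) f = 0 := by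
  set g := X (Sum.inl (0, 0)) * pderiv (Sum.inl (0, 1)) f + X (Sum.inl (1, 0)) * pderiv (Sum.inl (1, 1)) f with hg_def
  have hEW := hf.hW
  rw [EW_eq] at hEW
  have hgL : g = X (Sum.inr 1) * pderiv (Sum.inr 0) f := by linear_combination hEW
  have hΔ0 := hf.harm 0
  have hΔ1 := hf.harm 1
  rw [Delta_apply, Fin.sum_univ_two] at hΔ0 hΔ1
  -- the weight `ω = colW 0 + wDeg` (pointwise non-negative) and the homogeneity of `g`
  have hfω : IsWeightedHomogeneous (colW 0 + wDeg) f (k₀ + e) := isWeightedHomogeneous_add_weight hf.col0 hf.wdeg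
  have hgω : IsWeightedHomogeneous (colW 0 + wDeg) g (k₀ + e + 1) := by
    refine IsWeightedHomogeneous.add ?_ ?_
    · exact isWeightedHomogeneous_of_eq ((isWeightedHomogeneous_X ℂ _ _).mul
        (hfω.pderiv (i := (Sum.inl (0, 1))) (n' := k₀ + e) (by simp [colW, wDeg]))) (by simp [colW, wDeg]; ring)
    · exact isWeightedHomogeneous_of_eq ((isWeightedHomogeneous_X ℂ _ _).mul
        (hfω.pderiv (i := (Sum.inl (1, 1))) (n' := k₀ + e) (by simp [colW, wDeg]))) (by simp [colW, wDeg]; ring)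
  have hEu := euler_identity hgω
  rw [sum_var] at hEu
  simp [colW, wDeg] at hEu
  -- `hEu : z00 ∂00 g + z10 ∂10 g + w1 ∂w1 g = (k₀ + e + 1) g`; now compute the three derivatives of `g`
  have d00 : pderiv (Sum.inl (0, 0)) g = X (Sum.inr 1) * pderiv (Sum.inl (0, 0)) (pderiv (Sum.inr 0) f) := by
    rw [hgL, pderiv_mul, pderiv_X_of_ne (by simp), zero_mul, zero_add]
  have d10 : pderiv (Sum.inl (1, 0)) g = X (Sum.inr 1) * pderiv (Sum.inl (1, 0)) (pderiv (Sum.inr 0) f) := by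
    rw [hgL, pderiv_mul, pderiv_X_of_ne (by simp), zero_mul, zero_add]
  have dw1 : pderiv (Sum.inr 1) g = X (Sum.inl (0, 0)) * pderiv (Sum.inl (0, 1)) (pderiv (Sum.inr 1) f)
      + X (Sum.inl (1, 0)) * pderiv (Sum.inl (1, 1)) (pderiv (Sum.inr 1) f) := by
    rw [hg_def, map_add, pderiv_mul, pderiv_mul, pderiv_X_of_ne (by simp), pderiv_X_of_ne (by simp),
      zero_mul, zero_add, zero_mul, zero_add, pderiv_comm (Sum.inr 1 : Var) (Sum.inl (0, 1)),
      pderiv_comm (Sum.inr 1 : Var) (Sum.inl (1, 1))]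
  rw [d00, d10, dw1] at hEu
  have hk : ((k₀ + e + 1 : ℤ) : Model) * g = 0 := by
    push_cast
    linear_combination -hEu + (X (Sum.inr 1) * X (Sum.inl (0, 0))) * hΔ0 + (X (Sum.inr 1) * X (Sum.inl (1, 0))) * hΔ1
  have hpos : 0 ≤ k₀ + e :=
    weight_nonneg_of_ne_zero hfω (fun v => by rcases v with ⟨a, j⟩ | j <;> fin_cases j <;> simp [colW, wDeg]) hf.ne
  rcases mul_eq_zero.mp hk with h | h
  · exact absurd h (by exact_mod_cast (show (k₀ + e + 1 : ℤ) ≠ 0 by omega))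
  · exact h

/-- `∂_{w_0} f = 0`: a joint highest-weight vector does not involve `w_0`. [cite: KonnoKonno2007, Lemma 5.3 (iii) p. 74] -/
theorem IsHWVector.pderiv_w0 (hf : IsHWVector f k₀ k₁ n₀ n₁ e) : pderiv (Sum.inr 0) f = 0 := by
  have hEW := hf.hW
  rw [EW_eq, hf.colRaise_eq_zero, zero_sub, neg_eq_zero] at hEW
  exact (mul_eq_zero.mp hEW).resolve_left (X_ne_zero _)

/-! ### (b) `e = 0` or `k₁ + e = 0` -/

/-- For a joint highest-weight vector, `e = 0 ∨ k₁ + e = 0`: with `∂_{w_0} f = 0` the harmonic equations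
`Σ_a z_{a1} Δ_a f = 0` say `Eul₁ (∂_{w_1} f) = 0`, and Euler's identities for `colW 1` and `wDeg` on `∂_{w_1} f` turn this
into `(k₁ + e) ∂_{w_1} f = 0`; if `∂_{w_1} f = 0` too then `f` has no `w` at all and `e = 0`.
[cite: KonnoKonno2007, Lemma 5.3 (iii) p. 74] -/
theorem IsHWVector.e_eq_zero_or (hf : IsHWVector f k₀ k₁ n₀ n₁ e) : e = 0 ∨ k₁ + e = 0 := by
  have hw0 := hf.pderiv_w0
  have hΔ0 := hf.harm 0
  have hΔ1 := hf.harm 1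
  rw [Delta_apply, Fin.sum_univ_two, hw0, map_zero, zero_add] at hΔ0 hΔ1
  have hΔ0' : pderiv (Sum.inl (0, 1)) (pderiv (Sum.inr 1) f) = 0 := hΔ0
  have hΔ1' : pderiv (Sum.inl (1, 1)) (pderiv (Sum.inr 1) f) = 0 := hΔ1
  have hc1 := euler_col1 (hf.col1.pderiv (i := (Sum.inr 1)) (n' := k₁ + 1) (by simp [colW]))
  have hwd := euler_wDeg (hf.wdeg.pderiv (i := (Sum.inr 1)) (n' := e - 1) (by simp [wDeg]))
  have hw0' : pderiv (Sum.inr 0) (pderiv (Sum.inr 1) f) = 0 := by rw [pderiv_comm, hw0, map_zero]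
  rw [hΔ0', hΔ1'] at hc1
  rw [hw0'] at hwd
  have hk : ((k₁ + e : ℤ) : Model) * pderiv (Sum.inr 1) f = 0 := by
    push_cast at hc1 hwd ⊢
    linear_combination (-1 : Model) * hc1 - hwd
  rcases mul_eq_zero.mp hk with hk | hk
  · exact Or.inr (by exact_mod_cast hk)
  · -- `∂_{w_1} f = 0` as well: no `w` at all, so `e = 0`
    left
    have hE := euler_wDeg hf.wdeg
    rw [hw0, hk, mul_zero, mul_zero, add_zero] at hE
    exact_mod_cast (mul_eq_zero.mp hE.symm).resolve_right hf.ne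

/-! ### (c) `k₀ = n₀` -/

/-- For a joint highest-weight vector, `k₀ = n₀`: differentiating `C f = 0` by `∂_{z_{10}}` and `E_V f = 0` by `∂_{z_{01}}`
and subtracting leaves `(z_{10}∂_{10} − z_{01}∂_{01}) ∂_{11} f = 0`, which Euler's identities for `colW 0` and `rowW 0` on
`∂_{11} f` evaluate to `(k₀ − n₀) ∂_{11} f`; if `∂_{11} f = 0` then `∂_{01} f = ∂_{10} f = 0` as well and the two Euler
identities on `f` itself compare directly. [cite: KonnoKonno2007, Lemma 5.3 (iii) p. 74] -/
theorem IsHWVector.k0_eq_n0 (hf : IsHWVector f k₀ k₁ n₀ n₁ e) : k₀ = n₀ := by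
  have hw0 := hf.pderiv_w0
  have hC := hf.colRaise_eq_zero
  have hR := hf.hV
  rw [EV_eq] at hR
  have E1 := euler_col0 hf.col0
  have E3 := euler_row0 hf.row0
  by_cases h11 : pderiv (Sum.inl (1, 1)) f = 0
  · -- then `∂01 f = 0 = ∂10 f`, and the two Euler identities compare directly
    rw [h11, mul_zero, add_zero] at hC hR
    have h01 : pderiv (Sum.inl (0, 1)) f = 0 := (mul_eq_zero.mp hC).resolve_left (X_ne_zero _)
    have h10 : pderiv (Sum.inl (1, 0)) f = 0 := (mul_eq_zero.mp hR).resolve_left (X_ne_zero _)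
    rw [h10, hw0] at E1
    rw [h01] at E3
    have hk : ((k₀ - n₀ : ℤ) : Model) * f = 0 := by
      push_cast
      linear_combination E3 - E1
    rcases mul_eq_zero.mp hk with hk | hk
    · have : k₀ - n₀ = 0 := by exact_mod_cast hk
      omega
    · exact absurd hk hf.ne
  · -- `∂10 (C f) − ∂01 (E_V f) = (z10 ∂10 − z01 ∂01) (∂11 f) = (k₀ − n₀) ∂11 f`
    have hC' := congrArg (pderiv (Sum.inl (1, 0))) hC
    have hR' := congrArg (pderiv (Sum.inl (0, 1))) hR
    simp only [map_add, pderiv_mul, map_zero, pderiv_X_self, one_mul] at hC' hR'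
    rw [pderiv_X_of_ne (by simp), zero_mul, zero_add] at hC' hR'
    rw [pderiv_comm (Sum.inl (0, 1) : Var) (Sum.inl (1, 0))] at hR'
    have e1 := euler_col0 (hf.col0.pderiv (i := (Sum.inl (1, 1))) (n' := k₀) (by simp [colW]))
    have e2 := euler_row0 (hf.row0.pderiv (i := (Sum.inl (1, 1))) (n' := n₀) (by simp [rowW]))
    have hw0' : pderiv (Sum.inr 0) (pderiv (Sum.inl (1, 1)) f) = 0 := by rw [pderiv_comm, hw0, map_zero]
    rw [hw0'] at e1
    have hk : ((k₀ - n₀ : ℤ) : Model) * pderiv (Sum.inl (1, 1)) f = 0 := by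
      push_cast
      linear_combination hC' - hR' - e1 + e2
    rcases mul_eq_zero.mp hk with hk | hk
    · have : k₀ - n₀ = 0 := by exact_mod_cast hk
      omega
    · exact absurd hk h11

/-! ### (d) Dominance `n₁ ≤ n₀` for `e = 0` (the extremal-monomial argument) -/

/-- For a joint highest-weight vector of `w`-degree `e = 0`, `n₁ ≤ n₀`: otherwise every support monomial contains `z_{11}`;
take one, `d`, with the least `z_{11}`-exponent `s ≥ 1`; the coefficient of `E_V f = z_{00}∂_{10} f + z_{01}∂_{11} f` at
`d · z_{01}/z_{11}` is `s · coeff_d f` plus a contribution from a monomial with `z_{11}`-exponent `s − 1`, which is absent —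
so `coeff_d f = 0`, a contradiction (characteristic `0`). [cite: KonnoKonno2007, Lemma 5.3 (iii) p. 74] -/
theorem IsHWVector.n1_le_n0 (hf : IsHWVector f k₀ k₁ n₀ n₁ e) (he : e = 0) : n₁ ≤ n₀ := by
  classical
  by_contra hlt
  rw [not_le] at hlt
  have hk0 := hf.k0_eq_n0
  have hne : f.support.Nonempty := by
    rw [Finset.nonempty_iff_ne_empty, Ne, MvPolynomial.support_eq_empty]
    exact hf.ne
  obtain ⟨d, hd, hmin⟩ := Finset.exists_min_image f.support (fun d => d (Sum.inl (1, 1))) hne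
  have hd' : coeff d f ≠ 0 := MvPolynomial.mem_support_iff.mp hd
  obtain ⟨e0, e1, e2, e3, e4⟩ := hf.support_eqs hd'
  have h11 : d (Sum.inl (1, 1)) ≠ 0 := by
    intro h0
    rw [h0] at e3
    omega
  set m := d - Finsupp.single (Sum.inl (1, 1)) 1 with hm
  have hmd : m + Finsupp.single (Sum.inl (1, 1)) 1 = d := Finsupp.sub_add_single_one_cancel h11
  have hR := hf.hV
  rw [EV_eq] at hR
  have key := congrArg (coeff (Finsupp.single (Sum.inl (0, 1)) 1 + m)) hR
  rw [coeff_add, coeff_zero, coeff_X_mul, coeff_pderiv, hmd,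
    coeff_X_mul_pderiv_of_ne (show (Sum.inl (0, 0) : Var) ≠ Sum.inl (1, 0) by simp)] at key
  have hvan : coeff (Finsupp.single (Sum.inl (0, 1)) 1 + m - Finsupp.single (Sum.inl (0, 0)) 1
      + Finsupp.single (Sum.inl (1, 0)) 1) f = 0 := by
    by_contra hne'
    have hle := hmin _ (MvPolynomial.mem_support_iff.mpr hne')
    simp [m] at hle
    omega
  rw [hvan, mul_zero, ite_self, zero_add] at key
  rcases mul_eq_zero.mp key with h | h
  · exact hd' h
  · exact Nat.cast_add_one_ne_zero _ h

/-! ### Lemma 5.3 (iii) at the level of weights, and the unconditional Lemma 7.10 -/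

/-- **Konno–Konno Lemma 5.3 (iii) at `U(2,1) × U(2,0)`, at the level of weights.**  Every joint harmonic
`K_V × K_W`-highest-weight vector of the model `ℂ[z_{aj}, w_j]` has the weights of some `Δ_{abcd} = kkVec α β d` with
`β = 0 ∨ d = 0` (`r + t ≤ p′ = 2`): `U(W)`-weight `(α+β, β−d)`, `U(2)_V`-weight `(α+β, β)`, `w`-degree `d`.
[cite: KonnoKonno2007, Lemma 5.3 (iii) p. 74] -/
theorem IsHWVector.weights (hf : IsHWVector f k₀ k₁ n₀ n₁ e) :
    ∃ α β d : ℕ, (β = 0 ∨ d = 0) ∧ k₀ = (α : ℤ) + β ∧ k₁ = (β : ℤ) - d ∧ n₀ = (α : ℤ) + β ∧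
      n₁ = (β : ℤ) ∧ e = (d : ℤ) := by
  obtain ⟨d, hd⟩ := exists_coeff_ne_zero hf.ne
  obtain ⟨e0, e1, e2, e3, e4⟩ := hf.support_eqs hd
  have hk0 := hf.k0_eq_n0
  rcases hf.e_eq_zero_or with he | hke
  · have hdom := hf.n1_le_n0 he
    exact ⟨(n₀ - n₁).toNat, n₁.toNat, 0, Or.inr rfl, by omega, by omega, by omega, by omega, by omega⟩
  · exact ⟨n₀.toNat, 0, e.toNat, Or.inl rfl, by omega, by omega, by omega, by omega, by omega⟩

/-- Every joint harmonic `K_V × K_W`-highest-weight vector of `ℂ[z_{aj}, w_j]` has the weights of an (explicit, harmonic)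
`Δ_{abcd}`: there are `α β d` with `β = 0 ∨ d = 0` such that `kkVec α β d = z_{00}^α (det z)^β w_1^d` is a joint harmonic
highest-weight vector with the SAME five weights. [cite: KonnoKonno2007, Lemma 5.3 (iii) p. 74] -/
theorem IsHWVector.exists_kkVec (hf : IsHWVector f k₀ k₁ n₀ n₁ e) :
    ∃ α β d : ℕ, (β = 0 ∨ d = 0) ∧ IsHWVector (kkVec α β d) k₀ k₁ n₀ n₁ e := by
  obtain ⟨α, β, d, hβd, rfl, rfl, rfl, rfl, rfl⟩ := hf.weights
  exact ⟨α, β, d, hβd, isHWVector_kkVec α β d hβd⟩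

/-- **Ichino's Lemma 7.10 / Konno–Konno Thm 5.4 at `(p,q;r,s) = (2,0;2,1)` — unconditional.**  The `K × K′`-types in
the joint harmonics of the explicit Fock model `ℂ[z_{aj}, w_j]` of `U(2,0) × U(2,1)` are exactly the printed pairs
`P.mu ⊠ P.mu′`, for every choice of the splitting exponents `(m₀, n₀)`.
[cite: KonnoKonno2007, Lemma 5.3 p. 74, Thm 5.4 p. 75; Ichino2022ThetaReal, §7.5 Lemma 7.10] -/
theorem lemma_7_10 (S : SplittingDatum) (hp : S.p = 2) (hq : S.q = 0) (hr : S.r = 2) (hs : S.s = 1) :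
    (explicitPosPlane S hp hr hs).Lemma_7_10 :=
  lemma_7_10_of_classification S hp hq hr hs fun _ _ _ _ _ _ hf => hf.weights

/-- **The consumer instance, hypothesis-free.**  `…Ichino2022.FockKTypeWorkedPlanes` derives from `(h : D.Lemma_7_10)` that
the `K′ = U(2) × U(1)`-type `(1,1;−2)` (`= ∧²𝔭₊`) is harmonic at `(2,0;2,1)` iff either `n₀ = −2` (paired with the character
`μ = ((3+m₀)/2, (3+m₀)/2)`) or `n₀ = 0` (paired with `μ = ((1+m₀)/2, (m₀−1)/2)`); for the explicit model `D =
explicitPosPlane S` this now holds outright. [cite: Ichino2022ThetaReal, §7.5 Lemma 7.10; KonnoKonno2007, Thm 5.4 p. 75] -/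
theorem corresponds_wedge_iff (S : SplittingDatum) (hp : S.p = 2) (hq : S.q = 0) (hr : S.r = 2) (hs : S.s = 1)
    (μ : KWt S.p S.q) (μ' : KWt S.r S.s)
    (h0 : μ'.1 ⟨0, by omega⟩ = 1) (h1 : μ'.1 ⟨1, by omega⟩ = 1) (h2 : μ'.2 ⟨0, by omega⟩ = -2) :
    (explicitPosPlane S hp hr hs).corresponds μ μ' ↔
      (S.n₀ = -2 ∧ ∀ i, μ.1 i = (3 + (S.m₀ : ℚ)) / 2) ∨
      (S.n₀ = 0 ∧ μ.1 ⟨0, by omega⟩ = (1 + (S.m₀ : ℚ)) / 2 ∧ μ.1 ⟨1, by omega⟩ = ((S.m₀ : ℚ) - 1) / 2) :=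
  WorkedLines.corresponds_wedge_iff_posPlane _ (lemma_7_10 S hp hq hr hs) hp hq hr hs μ μ' h0 h1 h2

end PosPlane

/-! ## §2 `U(2,1) × U(1,1)`: the model `ℂ[z_a, w, y_a, v]` of `…JointHarmonicsMixedPlane` -/

namespace MixedPlane

-- Variables: `(Sum.inl a, 0)` is `z_a` (`V⁺ ⊗ W⁺`), `(Sum.inr (), 0)` is `w` (`V⁻ ⊗ W⁺`), `(Sum.inl a, 1)` is `y_a`
-- (`V⁺ ⊗ W⁻`), `(Sum.inr (), 1)` is `v` (`V⁻ ⊗ W⁻`).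

/-- A sum over the six variables, written out. [folklore] -/
private theorem sum_var {β : Type*} [AddCommMonoid β] (F : Var → β) :
    ∑ u, F u = F (Sum.inl 0, 0) + F (Sum.inl 1, 0) + F (Sum.inr (), 0) + F (Sum.inl 0, 1) + F (Sum.inl 1, 1)
      + F (Sum.inr (), 1) := by
  rw [Fintype.sum_prod_type, Fintype.sum_sum_type]
  simp only [Fin.sum_univ_two, Fintype.sum_unique]
  abel

variable {f : Model} {kP kM n₀ n₁ nv : ℤ}

/-- `E_V = z_0 ∂_{z_1} − y_1 ∂_{y_0}` as an operator on the model. [cite: KonnoKonno2007, §5.2 (5.3) p. 72] -/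
theorem EV_eq (g : Model) :
    EV g = X (Sum.inl 0, 0) * pderiv (Sum.inl 1, 0) g - X (Sum.inl 1, 1) * pderiv (Sum.inl 0, 1) g := by
  have : EV = (X (Sum.inl 0, 0) : Model) • pderiv (Sum.inl 1, 0)
      - (X (Sum.inl 1, 1) : Model) • pderiv (Sum.inl 0, 1) := by
    refine MvPolynomial.derivation_ext (fun u => ?_)
    rcases u with ⟨a | u, c⟩
    · fin_cases a <;> fin_cases c <;> simp [evGen]
    · fin_cases c <;> simp [evGen]
  simpa [smul_eq_mul, sub_eq_add_neg] using congrArg (fun D => D g) this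

/-- The five torus weights of a monomial `d` in the support of a joint highest-weight vector:
`d_{z0} + d_{z1} − d_w = kP`, `d_v − d_{y0} − d_{y1} = kM`, `d_{z0} − d_{y0} = n₀`, `d_{z1} − d_{y1} = n₁`, `d_v − d_w = nv`.
[cite: KonnoKonno2007, Lemma 5.2 p. 73] -/
theorem IsHWVector.support_eqs (hf : IsHWVector f kP kM n₀ n₁ nv) {d : Var →₀ ℕ} (hd : coeff d f ≠ 0) :
    (d (Sum.inl 0, 0) : ℤ) + d (Sum.inl 1, 0) - d (Sum.inr (), 0) = kP ∧
      (d (Sum.inr (), 1) : ℤ) - d (Sum.inl 0, 1) - d (Sum.inl 1, 1) = kM ∧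
      (d (Sum.inl 0, 0) : ℤ) - d (Sum.inl 0, 1) = n₀ ∧ (d (Sum.inl 1, 0) : ℤ) - d (Sum.inl 1, 1) = n₁ ∧
      (d (Sum.inr (), 1) : ℤ) - d (Sum.inr (), 0) = nv := by
  have h0 := sum_mul_weight_eq_of_coeff_ne_zero hf.colP hd
  have h1 := sum_mul_weight_eq_of_coeff_ne_zero hf.colM hd
  have h2 := sum_mul_weight_eq_of_coeff_ne_zero hf.row0 hd
  have h3 := sum_mul_weight_eq_of_coeff_ne_zero hf.row1 hd
  have h4 := sum_mul_weight_eq_of_coeff_ne_zero hf.uone hd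
  rw [sum_var] at h0 h1 h2 h3 h4
  simp [MixedPlane.colP, MixedPlane.colM, rowW, uOneV] at h0 h1 h2 h3 h4
  refine ⟨?_, ?_, ?_, ?_, ?_⟩ <;> linarith

/-- The single-term families `Δ⁺_0 = ∂_{z_0}∂_w`, `Δ⁻_1 = ∂_{y_1}∂_v`, `D₋ = ∂_v∂_w` of (5.1): in a monomial of a joint
harmonic, `z_0` and `w` do not both occur, nor `y_1` and `v`, nor `v` and `w`. [cite: KonnoKonno2007, §5.1 (5.1) p. 71] -/
theorem IsHWVector.support_muls (hf : IsHWVector f kP kM n₀ n₁ nv) {d : Var →₀ ℕ} (hd : coeff d f ≠ 0) :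
    d (Sum.inl 0, 0) * d (Sum.inr (), 0) = 0 ∧ d (Sum.inl 1, 1) * d (Sum.inr (), 1) = 0 ∧
      d (Sum.inr (), 1) * d (Sum.inr (), 0) = 0 :=
  ⟨mul_apply_eq_zero_of_pderiv_pderiv (by simp) (hf.harm.deltaP 0) hd,
    mul_apply_eq_zero_of_pderiv_pderiv (by simp) (hf.harm.deltaM 1) hd,
    mul_apply_eq_zero_of_pderiv_pderiv (by simp) hf.harm.dminus hd⟩

/-- **The Casimir-type identity.**  For a joint highest-weight vector `f`, `z_1` and `y_0` do not occur in `f`: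
`z_1 · ∂_{z_0}(E_V f) − y_0 · ∂_{y_1}(E_V f) + (z_0 y_0 + z_1 y_1) · D₊ f` — zero, since `E_V f = 0 = D₊ f` — equals the
DIAGONAL operator `N_{z_1} + N_{y_0} + N_{z_0}N_{z_1} + N_{y_0}N_{y_1} + N_{z_0}N_{y_0} + N_{z_1}N_{y_1}` applied to `f`, whose
eigenvalue on a support monomial `d` is a sum of non-negative integers containing `d_{z_1} + d_{y_0}`.
[cite: KonnoKonno2007, Lemma 5.3 (iii) p. 74] -/
theorem IsHWVector.support_z1_y0 (hf : IsHWVector f kP kM n₀ n₁ nv) {d : Var →₀ ℕ} (hd : coeff d f ≠ 0) :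
    d (Sum.inl 1, 0) = 0 ∧ d (Sum.inl 0, 1) = 0 := by
  have hE := hf.hV
  rw [EV_eq] at hE
  have hD := hf.harm.dplus
  rw [Dplus_apply, Fin.sum_univ_two] at hD
  have hD' : pderiv (Sum.inl 0, 0) (pderiv (Sum.inl 0, 1) f) + pderiv (Sum.inl 1, 0) (pderiv (Sum.inl 1, 1) f) = 0 := hD
  have F0a := congrArg (pderiv (Sum.inl 0, 0)) hE
  have F0b := congrArg (pderiv (Sum.inl 1, 1)) hE
  simp only [map_sub, pderiv_mul, map_zero, pderiv_X_self, one_mul] at F0a F0b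
  rw [pderiv_X_of_ne (by simp), zero_mul, zero_add] at F0a F0b
  rw [pderiv_comm ((Sum.inl 1, 1) : Var) (Sum.inl 1, 0), pderiv_comm ((Sum.inl 1, 1) : Var) (Sum.inl 0, 1)] at F0b
  -- the diagonal identity
  have diag : X (Sum.inl 1, 0) * pderiv (Sum.inl 1, 0) f + X (Sum.inl 0, 1) * pderiv (Sum.inl 0, 1) f
      + X (Sum.inl 0, 0) * (X (Sum.inl 1, 0) * pderiv (Sum.inl 0, 0) (pderiv (Sum.inl 1, 0) f))
      + X (Sum.inl 0, 1) * (X (Sum.inl 1, 1) * pderiv (Sum.inl 0, 1) (pderiv (Sum.inl 1, 1) f))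
      + X (Sum.inl 0, 0) * (X (Sum.inl 0, 1) * pderiv (Sum.inl 0, 0) (pderiv (Sum.inl 0, 1) f))
      + X (Sum.inl 1, 0) * (X (Sum.inl 1, 1) * pderiv (Sum.inl 1, 0) (pderiv (Sum.inl 1, 1) f)) = 0 := by
    linear_combination (X (Sum.inl 1, 0)) * F0a + (-X (Sum.inl 0, 1)) * F0b
      + (X (Sum.inl 0, 0) * X (Sum.inl 0, 1) + X (Sum.inl 1, 0) * X (Sum.inl 1, 1)) * hD'
  have key := congrArg (coeff d) diag
  rw [coeff_add, coeff_add, coeff_add, coeff_add, coeff_add, coeff_zero, coeff_X_mul_pderiv_self,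
    coeff_X_mul_pderiv_self, coeff_X_mul_X_mul_pderiv_pderiv (by simp), coeff_X_mul_X_mul_pderiv_pderiv (by simp),
    coeff_X_mul_X_mul_pderiv_pderiv (by simp), coeff_X_mul_X_mul_pderiv_pderiv (by simp)] at key
  -- read off the coefficient at `d`
  set A₀ := d (Sum.inl 0, 0)
  set A₁ := d (Sum.inl 1, 0)
  set C₀ := d (Sum.inl 0, 1)
  set C₁ := d (Sum.inl 1, 1)
  have key' : ((A₁ + C₀ + (A₀ * A₁ + C₀ * C₁ + A₀ * C₀ + A₁ * C₁) : ℕ) : ℂ) * coeff d f = 0 := by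
    push_cast
    linear_combination key
  have hnat : A₁ + C₀ + (A₀ * A₁ + C₀ * C₁ + A₀ * C₀ + A₁ * C₁) = 0 := by
    exact_mod_cast (mul_eq_zero.mp key').resolve_right hd
  generalize A₀ * A₁ + C₀ * C₁ + A₀ * C₀ + A₁ * C₁ = P at hnat
  constructor <;> omega

/-- **Konno–Konno Lemma 5.3 (iii) at `U(2,1) × U(1,1)`, at the level of weights.**  Every joint harmonic
`K_V × K_W`-highest-weight vector of the model `ℂ[z_a, w, y_a, v]` has the weights of some `Δ_{abcd} = kkVec i j k l =
z_0^i w^j v^k y_1^l` with `(j = 0 ∨ k = 0) ∧ (i = 0 ∨ j = 0) ∧ (l = 0 ∨ k = 0)`: `U(W⁺)`-weight `i − j`, `U(W⁻)`-weight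
`k − l`, `U(2)_V`-weight `(i, −l)`, `U(V⁻)`-weight `k − j`. [cite: KonnoKonno2007, Lemma 5.3 (iii) p. 74] -/
theorem IsHWVector.weights (hf : IsHWVector f kP kM n₀ n₁ nv) :
    ∃ i j k l : ℕ, ((j = 0 ∨ k = 0) ∧ (i = 0 ∨ j = 0) ∧ (l = 0 ∨ k = 0)) ∧
      kP = (i : ℤ) - j ∧ kM = (k : ℤ) - l ∧ n₀ = (i : ℤ) ∧ n₁ = -(l : ℤ) ∧ nv = (k : ℤ) - j := by
  obtain ⟨d, hd⟩ := exists_coeff_ne_zero hf.ne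
  obtain ⟨e0, e1, e2, e3, e4⟩ := hf.support_eqs hd
  obtain ⟨m1, m2, m3⟩ := hf.support_muls hd
  obtain ⟨hz1, hy0⟩ := hf.support_z1_y0 hd
  refine ⟨d (Sum.inl 0, 0), d (Sum.inr (), 0), d (Sum.inr (), 1), d (Sum.inl 1, 1), ⟨?_, ?_, ?_⟩,
    by omega, by omega, by omega, by omega, by omega⟩
  · rcases Nat.mul_eq_zero.mp m3 with h | h
    · exact Or.inr h
    · exact Or.inl h
  · exact Nat.mul_eq_zero.mp m1
  · exact Nat.mul_eq_zero.mp m2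

/-- Every joint harmonic `K_V × K_W`-highest-weight vector of `ℂ[z_a, w, y_a, v]` has the weights of an (explicit, harmonic)
`Δ_{abcd}`: there are admissible `i j k l` such that `kkVec i j k l = z_0^i w^j v^k y_1^l` is a joint harmonic
highest-weight vector with the SAME five weights. [cite: KonnoKonno2007, Lemma 5.3 (iii) p. 74] -/
theorem IsHWVector.exists_kkVec (hf : IsHWVector f kP kM n₀ n₁ nv) :
    ∃ i j k l : ℕ, ((j = 0 ∨ k = 0) ∧ (i = 0 ∨ j = 0) ∧ (l = 0 ∨ k = 0)) ∧
      IsHWVector (kkVec i j k l) kP kM n₀ n₁ nv := by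
  obtain ⟨i, j, k, l, hc, rfl, rfl, rfl, rfl, rfl⟩ := hf.weights
  exact ⟨i, j, k, l, hc, isHWVector_kkVec i j k l hc⟩

/-- **Ichino's Lemma 7.10 / Konno–Konno Thm 5.4 at `(p,q;r,s) = (1,1;2,1)` — unconditional.**  The `K × K′`-types in
the joint harmonics of the explicit Fock model `ℂ[z_a, w, y_a, v]` of `U(1,1) × U(2,1)` are exactly the printed pairs
`P.mu ⊠ P.mu′`, for every choice of the splitting exponents `(m₀, n₀)`.
[cite: KonnoKonno2007, Lemma 5.3 p. 74, Thm 5.4 p. 75; Ichino2022ThetaReal, §7.5 Lemma 7.10] -/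
theorem lemma_7_10 (S : SplittingDatum) (hp : S.p = 1) (hq : S.q = 1) (hr : S.r = 2) (hs : S.s = 1) :
    (explicitMixedPlane S hp hq hr hs).Lemma_7_10 :=
  lemma_7_10_of_classification S hp hq hr hs fun _ _ _ _ _ _ hf => hf.weights

end MixedPlane

end

end Literature.RepresentationTheory.KonnoKonno2007
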